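import Mathlib
import HarnessLib
import Summits.Ventures.LatticeQCDFlow.Scoring.GaussianShiftedBallThreshold

/-!
# SHIFTED SECTIONS UNDER `N(0,1) ⊗ ν`: FOR EVERY MEASURABLE THRESHOLD `g`, THE PROBABILITY
# `κ ↦ (N(0,1) ⊗ ν){(u, y) | (u + κ)² ≤ g(y)}` IS `∫ N(0,1){(t + κ)² ≤ g(y)} dν(y)`, EVEN,
# NON-INCREASING ON `[0, ∞)`, CONTINUOUS, TENDS TO `0`, AND STRICTLY DECREASING WHEN `ν{g > 0} > 0`
# (the common engine behind shifted balls — non-central `χ²` — and shifted cones — non-central `t`/`F`)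

HONEST FRAMING: exact (Metropolis-corrected) sampling algorithms for lattice gauge theory;
figures of merit are autocorrelation/cost numbers at stated couplings and volumes; no
continuum-physics claim.

Venture `LatticeQCDFlow` (cell pub-lqcd), topic `Scoring`; FANOUT row 4 (`s0-u1-b`, GEN-34).
NEW WORK of the cell (classical), no definition, nothing cited as a fact.

WHY (row 4).  `Scoring/GaussianShiftedBallMonotone` / `…Threshold` treat the non-central `χ²`-type
event `{(z_{r₁} + κ)² + Σ z_r² ≤ c}` coordinate-wise.  The limit events of the cell's FIXED-COUNT
criteria (Student-type: `{|z₀ + κ| ≤ t √(Σ_j w_j²/m)}`, row 4 GEN-32/33 and row 13) are shifted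
CONES, `{(u + κ)² ≤ g(w)}` with `g(w) = t² Σ_j w_j²/m`, living on a binary product `N(0,1) ⊗ ν`.
This file proves the operating facts once for an ARBITRARY measurable threshold `g` on an
arbitrary finite measure space `(Y, ν)`: Fubini (`Measure.prod_apply_symm`) writes the probability
as `∫⁻ y, N(0,1){t | (t + κ)² ≤ g(y)} dν`, and everything follows from the one-dimensional section
facts of `Scoring/GaussianShiftedBallMonotone` / `…Threshold` — evenness, monotonicity in `κ ≥ 0`,
continuity and the limit `0` at `∞` by dominated convergence, strict decrease as soon as `ν`
charges `{g > 0}`.  The Student-type application (local power of the fixed-count criteria is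
monotone in the drift) is a separate file.

## Content (`γ = gaussianReal 0 1`, `ν` finite, `g : Y → ℝ` measurable)

* `measurableSet_shiftedSection`, **`prod_shiftedSection_eq_lintegral`**;
* **`prod_shiftedSection_mono`** / `prod_shiftedSection_antitoneOn` (non-increasing on `[0, ∞)`),
  `prod_shiftedSection_neg` (even);
* **`tendsto_prod_shiftedSection_atTop`** (`→ 0`), **`continuous_prod_shiftedSection`**;
* **`prod_shiftedSection_strictAntiOn`** (`ν{g > 0} ≠ 0` ⇒ strictly decreasing on `[0, ∞)`);
  `existsUnique_Ici_of_strictAntiOn_tendsto_zero` (threshold calculus) and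
  **`prod_shiftedSection_threshold_existsUnique`** (every `β ∈ (0, F(0))` at exactly one `κ ≥ 0`).

NOT CLAIMED: the Student-type instances (separate file); rates; numerical values.
-/

open MeasureTheory ProbabilityTheory Filter Topology
open scoped ENNReal

namespace Summit.Ventures.LatticeQCDFlow.Scoring

open Set

section Product

variable {Y : Type*} [MeasurableSpace Y] {ν : Measure Y} [IsFiniteMeasure ν] {g : Y → ℝ}

/-- The shifted section event is measurable. -/
theorem measurableSet_shiftedSection (hg : Measurable g) (κ : ℝ) :
    MeasurableSet {p : ℝ × Y | (p.1 + κ) ^ 2 ≤ g p.2} :=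
  measurableSet_le (by fun_prop) (hg.comp measurable_snd)

/-- **Fubini**: `(γ ⊗ ν){(u, y) | (u + κ)² ≤ g y} = ∫⁻ y, γ{t | (t + κ)² ≤ g y} dν`. [ours] -/
theorem prod_shiftedSection_eq_lintegral (hg : Measurable g) (κ : ℝ) :
    ((gaussianReal 0 1).prod ν) {p : ℝ × Y | (p.1 + κ) ^ 2 ≤ g p.2}
      = ∫⁻ y, (gaussianReal 0 1) {t : ℝ | (t + κ) ^ 2 ≤ g y} ∂ν := by
  rw [Measure.prod_apply_symm (measurableSet_shiftedSection hg κ)]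
  rfl

/-- The section measure is a measurable function of `y` (as `ℝ≥0∞`). -/
theorem measurable_gaussianReal_sqShift_section (hg : Measurable g) (κ : ℝ) :
    Measurable fun y : Y => (gaussianReal 0 1) {t : ℝ | (t + κ) ^ 2 ≤ g y} := by
  have h := measurable_gaussianReal_real_sqShift_comp κ hg
  have e : (fun y : Y => (gaussianReal 0 1) {t : ℝ | (t + κ) ^ 2 ≤ g y})
      = fun y => ENNReal.ofReal ((gaussianReal 0 1).real {t : ℝ | (t + κ) ^ 2 ≤ g y}) := by
    funext y; rw [measureReal_def, ENNReal.ofReal_toReal (measure_ne_top _ _)]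
  rw [e]
  exact ENNReal.measurable_ofReal.comp h

/-- **Non-increasing in `κ ≥ 0`**: `0 ≤ κ ≤ κ'` ⇒ the section probability at `κ'` is `≤` that at `κ`. [ours] -/
theorem prod_shiftedSection_mono (hg : Measurable g) {κ κ' : ℝ} (hκ : 0 ≤ κ) (hle : κ ≤ κ') :
    ((gaussianReal 0 1).prod ν) {p : ℝ × Y | (p.1 + κ') ^ 2 ≤ g p.2}
      ≤ ((gaussianReal 0 1).prod ν) {p : ℝ × Y | (p.1 + κ) ^ 2 ≤ g p.2} := by
  rw [prod_shiftedSection_eq_lintegral hg, prod_shiftedSection_eq_lintegral hg]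
  exact lintegral_mono fun y => gaussianReal_sqShift_le_mono hκ hle _

/-- Real-valued `AntitoneOn [0, ∞)` form. -/
theorem prod_shiftedSection_antitoneOn (hg : Measurable g) :
    AntitoneOn (fun κ : ℝ => ((gaussianReal 0 1).prod ν).real {p : ℝ × Y | (p.1 + κ) ^ 2 ≤ g p.2})
      (Ici 0) := by
  intro κ hκ κ' _ hle
  simp only [measureReal_def]
  exact (ENNReal.toReal_le_toReal (measure_ne_top _ _) (measure_ne_top _ _)).2
    (prod_shiftedSection_mono hg (Set.mem_Ici.1 hκ) hle)

/-- **Even in `κ`.** [ours] -/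
theorem prod_shiftedSection_neg (hg : Measurable g) (κ : ℝ) :
    ((gaussianReal 0 1).prod ν) {p : ℝ × Y | (p.1 + -κ) ^ 2 ≤ g p.2}
      = ((gaussianReal 0 1).prod ν) {p : ℝ × Y | (p.1 + κ) ^ 2 ≤ g p.2} := by
  rw [prod_shiftedSection_eq_lintegral hg, prod_shiftedSection_eq_lintegral hg]
  exact lintegral_congr fun y => gaussianReal_sqShift_neg κ _

/-- **`→ 0` as `κ → ∞`** (dominated convergence; `ν` finite). [ours] -/
theorem tendsto_prod_shiftedSection_atTop (hg : Measurable g) :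
    Tendsto (fun κ : ℝ => ((gaussianReal 0 1).prod ν).real {p : ℝ × Y | (p.1 + κ) ^ 2 ≤ g p.2})
      atTop (𝓝 0) := by
  have hlin : Tendsto (fun κ : ℝ => ∫⁻ y, (gaussianReal 0 1) {t : ℝ | (t + κ) ^ 2 ≤ g y} ∂ν)
      atTop (𝓝 (∫⁻ _ : Y, (0 : ℝ≥0∞) ∂ν)) := by
    refine tendsto_lintegral_filter_of_dominated_convergence (fun _ => 1)
      (Eventually.of_forall fun κ => measurable_gaussianReal_sqShift_section hg κ)
      (Eventually.of_forall fun κ => Eventually.of_forall fun y => prob_le_one) ?_ ?_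
    · simp
    · refine Eventually.of_forall fun y => ?_
      have h1 : Tendsto (fun κ : ℝ => (gaussianReal 0 1).real {t : ℝ | (t + κ) ^ 2 ≤ g y}) atTop (𝓝 0) := by
        rcases lt_or_ge (g y) 0 with hρ | hρ
        · simp only [setOf_sqShift_le_of_neg hρ, measureReal_empty]
          exact tendsto_const_nhds
        · simp only [gaussianReal_real_sqShift_le, if_pos hρ]
          exact CardConsistency.tendsto_gaussianReal_real_Icc_atTop (Real.sqrt (g y))
      have h2 := (ENNReal.continuous_ofReal.tendsto 0).comp h1
      rw [ENNReal.ofReal_zero] at h2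
      refine h2.congr fun κ => ?_
      simp only [Function.comp_apply, measureReal_def, ENNReal.ofReal_toReal (measure_ne_top _ _)]
  rw [lintegral_zero] at hlin
  have h3 := (ENNReal.tendsto_toReal ENNReal.zero_ne_top).comp hlin
  rw [ENNReal.toReal_zero] at h3
  refine h3.congr fun κ => ?_
  simp only [Function.comp_apply, measureReal_def, prod_shiftedSection_eq_lintegral hg]

/-- Bochner form: the real probability is `∫ y, N(0,1).real{(t + κ)² ≤ g y} dν`. [ours] -/
theorem prod_shiftedSection_eq_integral (hg : Measurable g) (κ : ℝ) :
    ((gaussianReal 0 1).prod ν).real {p : ℝ × Y | (p.1 + κ) ^ 2 ≤ g p.2}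
      = ∫ y, (gaussianReal 0 1).real {t : ℝ | (t + κ) ^ 2 ≤ g y} ∂ν := by
  rw [integral_eq_lintegral_of_nonneg_ae (Eventually.of_forall fun y => measureReal_nonneg)
    (measurable_gaussianReal_real_sqShift_comp κ hg).aestronglyMeasurable, measureReal_def,
    prod_shiftedSection_eq_lintegral hg]
  congr 1
  refine lintegral_congr fun y => ?_
  rw [measureReal_def, ENNReal.ofReal_toReal (measure_ne_top _ _)]

/-- **Continuous in `κ`.** [ours] -/
theorem continuous_prod_shiftedSection (hg : Measurable g) :
    Continuous fun κ : ℝ => ((gaussianReal 0 1).prod ν).real {p : ℝ × Y | (p.1 + κ) ^ 2 ≤ g p.2} := by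
  simp only [prod_shiftedSection_eq_integral hg]
  refine continuous_of_dominated (bound := fun _ => 1) ?_ ?_ (integrable_const 1) ?_
  · exact fun κ => (measurable_gaussianReal_real_sqShift_comp κ hg).aestronglyMeasurable
  · intro κ
    refine Eventually.of_forall fun y => ?_
    rw [Real.norm_eq_abs, abs_of_nonneg measureReal_nonneg]
    exact measureReal_le_one
  · exact Eventually.of_forall fun y => continuous_gaussianReal_real_sqShift _

/-- **Strictly decreasing on `[0, ∞)` as soon as `ν` charges `{g > 0}`.** [ours] -/
theorem prod_shiftedSection_strictAntiOn (hg : Measurable g) (hpos : ν {y | 0 < g y} ≠ 0) :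
    StrictAntiOn (fun κ : ℝ => ((gaussianReal 0 1).prod ν).real {p : ℝ × Y | (p.1 + κ) ^ 2 ≤ g p.2})
      (Ici 0) := by
  intro κ hκ κ' hκ' hlt
  rw [Set.mem_Ici] at hκ hκ'
  simp only [measureReal_def]
  refine (ENNReal.toReal_lt_toReal (measure_ne_top _ _) (measure_ne_top _ _)).2 ?_
  rw [prod_shiftedSection_eq_lintegral hg, prod_shiftedSection_eq_lintegral hg]
  refine lintegral_strict_mono_of_ae_le_of_ae_lt_on (measurable_gaussianReal_sqShift_section hg κ).aemeasurable
    ?_ ?_ hpos ?_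
  · refine ne_of_lt (lt_of_le_of_lt (lintegral_mono fun y => prob_le_one) ?_)
    simp [measure_lt_top]
  · exact Eventually.of_forall fun y => gaussianReal_sqShift_le_mono hκ hlt.le _
  · refine Eventually.of_forall fun y hy => ?_
    have h := gaussianReal_real_sqShift_lt hκ hlt hy
    simp only [measureReal_def] at h
    exact (ENNReal.toReal_lt_toReal (measure_ne_top _ _) (measure_ne_top _ _)).1 h

/-- **Threshold calculus** (pure real analysis): a function continuous on `ℝ`, strictly decreasing on
`[0, ∞)` and tending to `0` at `∞` takes every value `β ∈ (0, F 0)` at exactly one `κ ≥ 0`. [ours] -/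
theorem existsUnique_Ici_of_strictAntiOn_tendsto_zero {F : ℝ → ℝ} (hcont : Continuous F)
    (hanti : StrictAntiOn F (Ici 0)) (hlim : Tendsto F atTop (𝓝 0)) {β : ℝ} (hβ0 : 0 < β)
    (hβ1 : β < F 0) : ∃! κ : ℝ, 0 ≤ κ ∧ F κ = β := by
  obtain ⟨K, hK⟩ := (hlim.eventually (gt_mem_nhds hβ0)).exists_forall_of_atTop
  set K' := max K 0 with hK'
  have hK'0 : 0 ≤ K' := le_max_right _ _
  have hFK' : F K' < β := hK K' (le_max_left _ _)
  have hivt := intermediate_value_Icc' hK'0 hcont.continuousOn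
  obtain ⟨κ, ⟨hκ0, _⟩, hκβ⟩ := hivt ⟨hFK'.le, hβ1.le⟩
  refine ⟨κ, ⟨hκ0, hκβ⟩, ?_⟩
  rintro κ₂ ⟨hκ₂0, hκ₂β⟩
  exact hanti.injOn (Set.mem_Ici.2 hκ₂0) (Set.mem_Ici.2 hκ0) (hκ₂β.trans hκβ.symm)

/-- **The detectable shift of a section event**: if `ν` charges `{g > 0}`, every target probability
`β ∈ (0, (γ ⊗ ν){u² ≤ g})` is attained at exactly one `κ ≥ 0`. [ours] -/
theorem prod_shiftedSection_threshold_existsUnique (hg : Measurable g) (hpos : ν {y | 0 < g y} ≠ 0)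
    {β : ℝ} (hβ0 : 0 < β)
    (hβ1 : β < ((gaussianReal 0 1).prod ν).real {p : ℝ × Y | (p.1 + 0) ^ 2 ≤ g p.2}) :
    ∃! κ : ℝ, 0 ≤ κ ∧ ((gaussianReal 0 1).prod ν).real {p : ℝ × Y | (p.1 + κ) ^ 2 ≤ g p.2} = β :=
  existsUnique_Ici_of_strictAntiOn_tendsto_zero (continuous_prod_shiftedSection hg)
    (prod_shiftedSection_strictAntiOn hg hpos) (tendsto_prod_shiftedSection_atTop hg) hβ0 hβ1

end Product

end Summit.Ventures.LatticeQCDFlow.Scoring
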